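import Summits.HodgeConjecture.CorCM.Census.OcticDecicWeilParts
import HarnessLib

/-!
# `E × B₄ × B₅` over an octic and a decic CM field sharing `k`: the composite parts SPLIT into curve points, quad parts and five parts,
# and every part is BALANCED at every pair of permutations

COR-CM (cell `pub-hodgecm2`), seat b30 gen 27 (2026-08-23); count-neutral own lane OCTIC-DECIC, sequel of
`Census/OcticDecicWeilParts.lean`; the degree-`(8,10)` twin of `Census/SexticDecicWeilPartsBalanced.lean`.  Theorems of the finite model
only; no definition, no named fact, no geometry, no `sorry`, no `decide`.

* §1 `IsSixFourPartOD.exists_split` (two curve points + quad part), `IsSixFivePartOD.exists_split` (curve point + five part),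
  `IsTenPartOD.exists_split` (curve point + quad part of sign `b` + five part of sign `¬b`), `IsFourteenPartOD.exists_split` (quad part of
  sign `b` + two five parts of sign `¬b`);
* §2 **balance at EVERY pair of permutations** via the defect law `Census/OcticDecicWeilDefect.balancedOD_of_defect`, with defects
  `(t₂, t₃; e) = (0, 0; 0)` (pair), `(±1, 0; ±2)` (six-four: `B₄ × E × E`), `(0, ±1; ±1)` (six-five: `B₅ × E`), `(±1, ∓1; ±1)` (ten:
  `E × B₄ × B̄₅`), `(±1, ∓2; 0)` (fourteen: `B₄ × B̄₅ × B̄₅`).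
[cite: MoonenZarhin1995Duke, Thm. 2.4] [cite: Gordon1999HodgeAVSurvey, 5.13 (ii), 9.2.2] [cite: Milne2020HodgeClassesAV, 1.2 (a)]

## References
* [MoonenZarhin1995Duke] B. Moonen, Yu. Zarhin, Duke Math. J. 77 (1995), Thm. 2.4.  [Gordon1999HodgeAVSurvey] B. B. Gordon, CRM
  Monogr. 10 (1999), 5.13 (ii), 9.2.2.  [Milne2020HodgeClassesAV] J. S. Milne, arXiv:2010.08857, 1.2 (a).
-/

namespace Summit.HodgeConjecture.CorCM.Census.OcticDecicWeil

open Finset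

variable {α : Type*} {v : α → PtOD}

/-! ### Splitting the composite parts -/

/-- A six-four part is its two curve points plus a quad part. [folklore] -/
theorem IsSixFourPartOD.exists_split [DecidableEq α] {b : Bool} {G : Finset α} (hG : IsSixFourPartOD v b G) :
    ∃ (C G₁ : Finset α), Disjoint C G₁ ∧ G = C ∪ G₁ ∧ C.card = 2 ∧ (∀ x ∈ C, v x = Sum.inl b) ∧ IsQuadPartOD v b G₁ := by
  set C := G.filter fun x => v x = Sum.inl b with hC
  obtain ⟨W, hW, hW'⟩ := exists_quadPartOD_of_counts (v := v) (T := G) b fun a => by rw [hG.2.2 a]; exact one_pos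
  have hCW : Disjoint C W := by
    rw [Finset.disjoint_left]
    intro x hxC hxW
    obtain ⟨a, ha⟩ := hW'.exists_eq hxW
    rw [(Finset.mem_filter.1 hxC).2] at ha; exact Sum.inl_ne_inr ha
  refine ⟨C, W, hCW, ?_, hG.2.1, fun x hx => (Finset.mem_filter.1 hx).2, hW'⟩
  symm
  apply Finset.eq_of_subset_of_card_le (Finset.union_subset (Finset.filter_subset _ _) hW)
  rw [Finset.card_union_of_disjoint hCW, hG.2.1, hW'.1, hG.1]

/-- A six-five part is its curve point plus a five part. [folklore] -/
theorem IsSixFivePartOD.exists_split [DecidableEq α] {b : Bool} {G : Finset α} (hG : IsSixFivePartOD v b G) :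
    ∃ (x : α) (G₁ : Finset α), x ∉ G₁ ∧ G = insert x G₁ ∧ v x = Sum.inl b ∧ IsFivePartOD v b G₁ := by
  obtain ⟨x, hxf⟩ := Finset.card_eq_one.1 hG.2.1
  have hx : x ∈ G.filter fun x => v x = Sum.inl b := by rw [hxf]; exact Finset.mem_singleton_self x
  obtain ⟨hxG, hvx⟩ := Finset.mem_filter.1 hx
  obtain ⟨W, hW, hW'⟩ := exists_fivePartOD_of_counts (v := v) (T := G) b fun a => by rw [hG.2.2 a]; exact one_pos
  have hxW : x ∉ W := fun h => by
    obtain ⟨a, ha⟩ := hW'.exists_eq h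
    rw [hvx] at ha; exact Sum.inl_ne_inr ha
  refine ⟨x, W, hxW, ?_, hvx, hW'⟩
  symm
  apply Finset.eq_of_subset_of_card_le (Finset.insert_subset hxG hW)
  rw [Finset.card_insert_of_notMem hxW, hW'.1, hG.1]

/-- A ten part is its curve point, a quad part of sign `b` and a five part of sign `¬b`. [folklore] -/
theorem IsTenPartOD.exists_split [DecidableEq α] {b : Bool} {G : Finset α} (hG : IsTenPartOD v b G) :
    ∃ (x : α) (G₁ G₂ : Finset α), x ∉ G₁ ∧ x ∉ G₂ ∧ Disjoint G₁ G₂ ∧ G = insert x (G₁ ∪ G₂) ∧ v x = Sum.inl b ∧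
      IsQuadPartOD v b G₁ ∧ IsFivePartOD v (!b) G₂ := by
  obtain ⟨x, hxf⟩ := Finset.card_eq_one.1 hG.2.1
  have hx : x ∈ G.filter fun x => v x = Sum.inl b := by rw [hxf]; exact Finset.mem_singleton_self x
  obtain ⟨hxG, hvx⟩ := Finset.mem_filter.1 hx
  obtain ⟨W₁, hW₁, hW₁'⟩ := exists_quadPartOD_of_counts (v := v) (T := G) b fun a => by rw [hG.2.2.1 a]; exact one_pos
  obtain ⟨W₂, hW₂, hW₂'⟩ := exists_fivePartOD_of_counts (v := v) (T := G) (!b) fun a => by rw [hG.2.2.2 a]; exact one_pos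
  have hxW₁ : x ∉ W₁ := fun h => by
    obtain ⟨a, ha⟩ := hW₁'.exists_eq h
    rw [hvx] at ha; exact Sum.inl_ne_inr ha
  have hxW₂ : x ∉ W₂ := fun h => by
    obtain ⟨a, ha⟩ := hW₂'.exists_eq h
    rw [hvx] at ha; exact Sum.inl_ne_inr ha
  have hW : Disjoint W₁ W₂ := by
    rw [Finset.disjoint_left]
    intro z hz1 hz2
    obtain ⟨a, ha⟩ := hW₁'.exists_eq hz1
    obtain ⟨a', ha'⟩ := hW₂'.exists_eq hz2
    have := ha.symm.trans ha'
    simp at this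
  refine ⟨x, W₁, W₂, hxW₁, hxW₂, hW, ?_, hvx, hW₁', hW₂'⟩
  symm
  apply Finset.eq_of_subset_of_card_le (Finset.insert_subset hxG (Finset.union_subset hW₁ hW₂))
  rw [Finset.card_insert_of_notMem (by rw [Finset.mem_union]; exact fun h => h.elim hxW₁ hxW₂),
    Finset.card_union_of_disjoint hW, hW₁'.1, hW₂'.1, hG.1]

/-- A fourteen part is a quad part of sign `b` and two five parts of sign `¬b`. [folklore] -/
theorem IsFourteenPartOD.exists_split [DecidableEq α] {b : Bool} {G : Finset α} (hG : IsFourteenPartOD v b G) :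
    ∃ (G₀ G₁ G₂ : Finset α), Disjoint G₀ G₁ ∧ Disjoint G₀ G₂ ∧ Disjoint G₁ G₂ ∧ G = G₀ ∪ G₁ ∪ G₂ ∧
      IsQuadPartOD v b G₀ ∧ IsFivePartOD v (!b) G₁ ∧ IsFivePartOD v (!b) G₂ := by
  obtain ⟨W₀, hW₀, hW₀'⟩ := exists_quadPartOD_of_counts (v := v) (T := G) b fun a => by rw [hG.2.1 a]; exact one_pos
  obtain ⟨W₁, hW₁, hW₁'⟩ := exists_fivePartOD_of_counts (v := v) (T := G) (!b) fun a => by rw [hG.2.2 a]; exact two_pos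
  have hrest : ∀ a : Fin 5, 0 < ((G \ W₁).filter fun x => v x = Sum.inr (Sum.inr (a, !b))).card := by
    intro a
    have h1 : ((G \ W₁).filter fun x => v x = Sum.inr (Sum.inr (a, !b))).card =
        (G.filter fun x => v x = Sum.inr (Sum.inr (a, !b))).card - (W₁.filter fun x => v x = Sum.inr (Sum.inr (a, !b))).card := by
      rw [← Finset.card_sdiff_of_subset (Finset.filter_subset_filter _ hW₁)]
      congr 1
      ext x
      simp only [Finset.mem_filter, Finset.mem_sdiff]
      tauto
    rw [h1, hG.2.2 a, hW₁'.2 a]; exact one_pos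
  obtain ⟨W₂, hW₂, hW₂'⟩ := exists_fivePartOD_of_counts (v := v) (T := G \ W₁) (!b) hrest
  have h12 : Disjoint W₁ W₂ := by
    rw [Finset.disjoint_left]
    exact fun z hz1 hz2 => (Finset.mem_sdiff.1 (hW₂ hz2)).2 hz1
  have h01 : Disjoint W₀ W₁ := by
    rw [Finset.disjoint_left]
    intro z hz0 hz1
    obtain ⟨a, ha⟩ := hW₀'.exists_eq hz0
    obtain ⟨a', ha'⟩ := hW₁'.exists_eq hz1
    have := ha.symm.trans ha'
    simp at this
  have h02 : Disjoint W₀ W₂ := by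
    rw [Finset.disjoint_left]
    intro z hz0 hz2
    obtain ⟨a, ha⟩ := hW₀'.exists_eq hz0
    obtain ⟨a', ha'⟩ := hW₂'.exists_eq hz2
    have := ha.symm.trans ha'
    simp at this
  refine ⟨W₀, W₁, W₂, h01, h02, h12, ?_, hW₀', hW₁', hW₂'⟩
  symm
  have hW₂G : W₂ ⊆ G := fun z hz => (Finset.mem_sdiff.1 (hW₂ hz)).1
  apply Finset.eq_of_subset_of_card_le (Finset.union_subset (Finset.union_subset hW₀ hW₁) hW₂G)
  rw [Finset.card_union_of_disjoint (Finset.disjoint_union_left.2 ⟨h02, h12⟩), Finset.card_union_of_disjoint h01,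
    hW₀'.1, hW₁'.1, hW₂'.1, hG.1]

/-! ### The parts are balanced at every pair of permutations -/

section Balanced

/-- **A pair part is balanced** (its count function is conjugation-invariant, so all defects vanish).
[cite: Gordon1999HodgeAVSurvey, 9.2.2] -/
theorem IsPairPartOD.balancedOD [DecidableEq α] {G : Finset α} (hG : IsPairPartOD v G)
    (π : Equiv.Perm (Fin 4) × Equiv.Perm (Fin 5)) : 2 * (G.filter fun x => v x ∈ phiOD π).card = G.card := by
  obtain ⟨y, hy⟩ := hG.count_eq
  have hsymm : ∀ z : PtOD, (G.filter fun x => v x = cjOD z).card = (G.filter fun x => v x = z).card := by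
    intro z
    rw [hy, hy]
    have h1 : cjOD z = y ↔ z = cjOD y := ⟨fun h => by rw [← h, cjOD_cjOD], fun h => by rw [h, cjOD_cjOD]⟩
    have h2 : cjOD z = cjOD y ↔ z = y := ⟨fun h => by rw [← cjOD_cjOD z, h, cjOD_cjOD], fun h => by rw [h]⟩
    simp only [h1, h2, or_comm]
  refine balancedOD_of_defect (v := v) (t₂ := 0) (t₃ := 0) (fun a => ?_) (fun a => ?_) ?_ π
  · have h := hsymm (Sum.inr (Sum.inl (a, true)))
    rw [cjOD_inr_inl, Bool.not_true] at h
    rw [h, sub_self]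
  · have h := hsymm (Sum.inr (Sum.inr (a, true)))
    rw [cjOD_inr_inr, Bool.not_true] at h
    rw [h, sub_self]
  · have h := hsymm (Sum.inl true)
    rw [cjOD_inl, Bool.not_true] at h
    rw [h, sub_self]; ring

/-- **A six-four part is balanced** (defects `(t₂, t₃; e) = (±1, 0; ±2)`: the Weil class of `B₄ × E × E`).
[cite: MoonenZarhin1995Duke, Thm. 2.4] -/
theorem IsSixFourPartOD.balancedOD [DecidableEq α] {b : Bool} {G : Finset α} (hG : IsSixFourPartOD v b G)
    (π : Equiv.Perm (Fin 4) × Equiv.Perm (Fin 5)) : 2 * (G.filter fun x => v x ∈ phiOD π).card = G.card := by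
  obtain ⟨C, G₁, hCG₁, rfl, hC, hvC, hG₁⟩ := hG.exists_split
  have hcount : ∀ z : PtOD, ((C ∪ G₁).filter fun x => v x = z).card =
      (if z = Sum.inl b then 2 else 0) + (G₁.filter fun x => v x = z).card := fun z => by
    rw [Finset.filter_union, Finset.card_union_of_disjoint (Finset.disjoint_filter_filter hCG₁)]
    congr 1
    by_cases hz : z = Sum.inl b
    · rw [if_pos hz, Finset.filter_true_of_mem fun x hx => (hvC x hx).trans hz.symm, hC]
    · rw [if_neg hz, Finset.card_eq_zero, Finset.filter_eq_empty_iff]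
      exact fun x hx h => hz (h.symm.trans (hvC x hx))
  refine balancedOD_of_defect (v := v) (t₂ := if b then 1 else -1) (t₃ := 0) (fun a => ?_) (fun a => ?_) ?_ π
  · rw [hcount, hcount, hG₁.card_filter_inr_inl, hG₁.card_filter_inr_inl, if_neg Sum.inr_ne_inl, if_neg Sum.inr_ne_inl]
    cases b <;> simp
  · rw [hcount, hcount, hG₁.card_filter_inr_inr, hG₁.card_filter_inr_inr, if_neg Sum.inr_ne_inl, if_neg Sum.inr_ne_inl]
    simp
  · rw [hcount, hcount, hG₁.card_filter_inl, hG₁.card_filter_inl]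
    cases b <;> simp

/-- **A six-five part is balanced** (defects `(0, ±1; ±1)`: the Weil class of `B₅ × E`). [cite: MoonenZarhin1995Duke, Thm. 2.4] -/
theorem IsSixFivePartOD.balancedOD [DecidableEq α] {b : Bool} {G : Finset α} (hG : IsSixFivePartOD v b G)
    (π : Equiv.Perm (Fin 4) × Equiv.Perm (Fin 5)) : 2 * (G.filter fun x => v x ∈ phiOD π).card = G.card := by
  obtain ⟨x, G₁, hxG₁, rfl, hvx, hG₁⟩ := hG.exists_split
  have hcount : ∀ z : PtOD, ((insert x G₁).filter fun x => v x = z).card =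
      (if z = Sum.inl b then 1 else 0) + (G₁.filter fun x => v x = z).card := fun z => by
    rw [Finset.filter_insert, hvx]
    by_cases hz : Sum.inl b = z
    · rw [if_pos hz, if_pos hz.symm, Finset.card_insert_of_notMem fun h => hxG₁ (Finset.mem_of_mem_filter _ h), add_comm]
    · rw [if_neg hz, if_neg (Ne.symm hz), zero_add]
  refine balancedOD_of_defect (v := v) (t₂ := 0) (t₃ := if b then 1 else -1) (fun a => ?_) (fun a => ?_) ?_ π
  · rw [hcount, hcount, hG₁.card_filter_inr_inl, hG₁.card_filter_inr_inl, if_neg Sum.inr_ne_inl, if_neg Sum.inr_ne_inl]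
    simp
  · rw [hcount, hcount, hG₁.card_filter_inr_inr, hG₁.card_filter_inr_inr, if_neg Sum.inr_ne_inl, if_neg Sum.inr_ne_inl]
    cases b <;> simp
  · rw [hcount, hcount, hG₁.card_filter_inl, hG₁.card_filter_inl]
    cases b <;> simp

/-- **A ten part is balanced** (defects `(±1, ∓1; ±1)`: the Weil class of `E × B₄ × B̄₅`). [cite: MoonenZarhin1995Duke, Thm. 2.4] -/
theorem IsTenPartOD.balancedOD [DecidableEq α] {b : Bool} {G : Finset α} (hG : IsTenPartOD v b G)
    (π : Equiv.Perm (Fin 4) × Equiv.Perm (Fin 5)) : 2 * (G.filter fun x => v x ∈ phiOD π).card = G.card := by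
  obtain ⟨x, G₁, G₂, hx₁, hx₂, h12, rfl, hvx, hG₁, hG₂⟩ := hG.exists_split
  have hcount : ∀ z : PtOD, ((insert x (G₁ ∪ G₂)).filter fun x => v x = z).card =
      (if z = Sum.inl b then 1 else 0) + (G₁.filter fun x => v x = z).card + (G₂.filter fun x => v x = z).card := fun z => by
    rw [Finset.filter_insert, hvx]
    have hU : ((G₁ ∪ G₂).filter fun x => v x = z).card = (G₁.filter fun x => v x = z).card + (G₂.filter fun x => v x = z).card := by
      rw [Finset.filter_union, Finset.card_union_of_disjoint (Finset.disjoint_filter_filter h12)]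
    by_cases hz : Sum.inl b = z
    · rw [if_pos hz, if_pos hz.symm, Finset.card_insert_of_notMem fun h => ?_, hU]; · ring
      rcases Finset.mem_union.1 (Finset.mem_of_mem_filter _ h) with h | h
      exacts [hx₁ h, hx₂ h]
    · rw [if_neg hz, if_neg (Ne.symm hz), zero_add, hU]
  refine balancedOD_of_defect (v := v) (t₂ := if b then 1 else -1) (t₃ := if b then -1 else 1) (fun a => ?_) (fun a => ?_) ?_ π
  · rw [hcount, hcount, hG₁.card_filter_inr_inl, hG₁.card_filter_inr_inl, hG₂.card_filter_inr_inl, hG₂.card_filter_inr_inl,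
      if_neg Sum.inr_ne_inl, if_neg Sum.inr_ne_inl]
    cases b <;> simp
  · rw [hcount, hcount, hG₁.card_filter_inr_inr, hG₁.card_filter_inr_inr, hG₂.card_filter_inr_inr, hG₂.card_filter_inr_inr,
      if_neg Sum.inr_ne_inl, if_neg Sum.inr_ne_inl]
    cases b <;> simp
  · rw [hcount, hcount, hG₁.card_filter_inl, hG₁.card_filter_inl, hG₂.card_filter_inl, hG₂.card_filter_inl]
    cases b <;> simp

/-- **A fourteen part is balanced** (defects `(±1, ∓2; 0)`: the Weil class of `B₄ × B̄₅ × B̄₅`). [cite: MoonenZarhin1995Duke, Thm. 2.4] -/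
theorem IsFourteenPartOD.balancedOD [DecidableEq α] {b : Bool} {G : Finset α} (hG : IsFourteenPartOD v b G)
    (π : Equiv.Perm (Fin 4) × Equiv.Perm (Fin 5)) : 2 * (G.filter fun x => v x ∈ phiOD π).card = G.card := by
  obtain ⟨G₀, G₁, G₂, h01, h02, h12, rfl, hG₀, hG₁, hG₂⟩ := hG.exists_split
  have hcount : ∀ z : PtOD, ((G₀ ∪ G₁ ∪ G₂).filter fun x => v x = z).card =
      (G₀.filter fun x => v x = z).card + (G₁.filter fun x => v x = z).card + (G₂.filter fun x => v x = z).card := fun z => by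
    rw [Finset.filter_union, Finset.card_union_of_disjoint (Finset.disjoint_filter_filter (Finset.disjoint_union_left.2 ⟨h02, h12⟩)),
      Finset.filter_union, Finset.card_union_of_disjoint (Finset.disjoint_filter_filter h01)]
  refine balancedOD_of_defect (v := v) (t₂ := if b then 1 else -1) (t₃ := if b then -2 else 2) (fun a => ?_) (fun a => ?_) ?_ π
  · rw [hcount, hcount, hG₀.card_filter_inr_inl, hG₀.card_filter_inr_inl, hG₁.card_filter_inr_inl, hG₁.card_filter_inr_inl,
      hG₂.card_filter_inr_inl, hG₂.card_filter_inr_inl]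
    cases b <;> simp
  · rw [hcount, hcount, hG₀.card_filter_inr_inr, hG₀.card_filter_inr_inr, hG₁.card_filter_inr_inr, hG₁.card_filter_inr_inr,
      hG₂.card_filter_inr_inr, hG₂.card_filter_inr_inr]
    cases b <;> simp
  · rw [hcount, hcount, hG₀.card_filter_inl, hG₀.card_filter_inl, hG₁.card_filter_inl, hG₁.card_filter_inl,
      hG₂.card_filter_inl, hG₂.card_filter_inl]
    cases b <;> simp

end Balanced

end Summit.HodgeConjecture.CorCM.Census.OcticDecicWeil
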